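import Literature.Geometry.GeometricMeasureTheory.FlatSliceDensity
import Literature.Geometry.GeometricMeasureTheory.SkeletonFaceCharts
import Literature.Geometry.GeometricMeasureTheory.CurrentsSlicingLipschitz
import HarnessLib

/-!
# Sphere slices of rectifiable currents carried by the cubical skeleton are rectifiable

Support file for the boundary-rectifiability theorem [Federer1969, 4.2.16 (2)] along White's
route [White1989, p. 210]: the induction step slices the cubical retraction `Q_ε` of a
rectifiable current by spheres. Federer's "`⟨T, u, r+⟩ ∈ 𝓡_{m-1}` for `ℒ¹` almost all `r`"
[Federer1969, 4.3.8 with 4.3.6] is proved here for rectifiable currents `Q ∈ 𝓡_{j+1}(V)` carried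
by the scaled `(j+1)`-skeleton `μ_ε W'_{j+1}` of `CubicalModel.lean`, WITHOUT any hypothesis on
`∂Q` beyond finite mass (so the densities on the faces are merely `L¹`, not constant):

for every centre `x` and almost every radius `r > 0`, the sphere slice
`∂(Q ⌞ 𝐁(x,r)) − (∂Q) ⌞ 𝐁(x,r) = ⟨Q, |· − x|², r²+⟩` is a rectifiable `j`-current
(`Current.IsRectifiable.ae_isRectifiable_sphereSlice`).

Proof: by `Current.IsRectifiable.exists_faceCharts` (`SkeletonFaceCharts.lean`) `Q` is a finite
sum of flat chart currents `∫_{C_z} θ_z(u) ω(Ψ_z u)(e_z) du` with `L¹` integer densities; on each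
face the squared distance `|Ψ_z(u) − x|² = K_z + Σ_l (u_l − c_l)²` has the single critical point
`c`, so `exists_sliceData_compact` (`FlatSliceDensity.lean`) applies off small balls around `c`,
whose contribution vanishes at almost every level; hence `Q(d gₙ ∧ φ) → E_s(φ)` for every test
form `φ` and a.e. `s`, with `E_s` rectifiable for a.e. `s`, while `Q(d gₙ ∧ φ) → ⟨Q, f, s+⟩(φ)`
(`Current.IsRepresentable.tendsto_wedgeD_slice`). A countable sup-dense family of test forms
(`TestFunction.exists_countable_sup_dense`) and the finiteness of the slice masses at almost
every radius (`Current.IsRepresentable.ae_mass_boundary_restrictSet_lt_top`, for the distance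
function) identify `⟨Q, f, r²+⟩ = E_{r²}` for a.e. `r`; finally `√·` maps null sets of levels to
null sets of radii.

Theorems only; no definitions, no named facts.

## References

* H. Federer, *Geometric Measure Theory*, Springer 1969, 4.1.7, 4.2.1, 4.3.6, 4.3.8
  [Federer1969].
* B. White, *A new proof of the compactness theorem for integral currents*, Comment. Math. Helv.
  64 (1989) 207–220, p. 210 [White1989].
-/

noncomputable section

open scoped ENNReal NNReal Topology ContDiff InnerProductSpace RealInnerProductSpace
open MeasureTheory TopologicalSpace Set Filter Metric Function Module

namespace Literature.Geometry.GeometricMeasureTheory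

set_option maxSynthPendingDepth 2

/-! ### Currents of finite mass are determined by a sup-dense family of test forms -/

section DenseExt

variable {E : Type*} [NormedAddCommGroup E] [NormedSpace ℝ E] {Ω : Opens E} {m : ℕ}

/-- **Two currents of finite mass agreeing on a sup-dense family of test forms are equal**
(`|T(φ)| ≤ 𝐌(T) sup |φ|`). [cite: Federer1969, 4.1.7] -/
theorem Current.eq_of_eqOn_supDense {D : Set (TestForm Ω m)}
    (hD : ∀ (φ : TestForm Ω m) (ε : ℝ), 0 < ε → ∃ d ∈ D, ∀ x, ‖φ x - d x‖ ≤ ε)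
    {T₁ T₂ : Current Ω m} (h₁ : T₁.mass ≠ ⊤) (h₂ : T₂.mass ≠ ⊤) (h : ∀ d ∈ D, T₁ d = T₂ d) :
    T₁ = T₂ := by
  ext φ
  refine eq_of_forall_dist_le fun ε hε => ?_
  set M : ℝ := T₁.mass.toReal + T₂.mass.toReal + 1 with hM
  have hM0 : 0 < M := by rw [hM]; positivity
  obtain ⟨d, hd, hφd⟩ := hD φ (ε / M) (div_pos hε hM0)
  have hsub : ∀ x, ‖(φ - d) x‖ ≤ ε / M := fun x => by
    have : (φ - d) x = φ x - d x := rfl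
    rw [this]; exact hφd x
  have h1 := T₁.abs_apply_le_mul_toReal_mass' h₁ (div_pos hε hM0).le hsub
  have h2 := T₂.abs_apply_le_mul_toReal_mass' h₂ (div_pos hε hM0).le hsub
  have heq : T₁ φ - T₂ φ = T₁ (φ - d) - T₂ (φ - d) := by
    rw [map_sub, map_sub, h d hd]; ring
  rw [Real.dist_eq, heq]
  calc |T₁ (φ - d) - T₂ (φ - d)| ≤ |T₁ (φ - d)| + |T₂ (φ - d)| := abs_sub _ _
    _ ≤ ε / M * T₁.mass.toReal + ε / M * T₂.mass.toReal := add_le_add h1 h2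
    _ = ε * ((T₁.mass.toReal + T₂.mass.toReal) / M) := by ring
    _ ≤ ε * 1 := by
        refine mul_le_mul_of_nonneg_left ?_ hε.le
        rw [div_le_one hM0, hM]; linarith
    _ = ε := mul_one ε

end DenseExt

/-! ### Slicing one flat chart current by spheres -/

section Face

variable {V : Type*} [NormedAddCommGroup V] [InnerProductSpace ℝ V] [FiniteDimensional ℝ V]
  [MeasurableSpace V] [BorelSpace V] {j : ℕ}

omit [FiniteDimensional ℝ V] [MeasurableSpace V] [BorelSpace V] in
/-- `d gₛ,ₕ ∧ φ` vanishes where `f ∉ [s, s + h]` (the kernel `(S(h⁻¹(· − s)))'` is supported in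
`[s, s+h]`). [cite: Federer1969, 4.2.1] -/
theorem TestForm.wedgeD_sliceApprox_apply_eq_zero {m : ℕ} {f : V → ℝ} (hf : ContDiff ℝ ∞ f)
    {s h : ℝ} (hh : 0 < h) (φ : TestForm (⊤ : Opens V) m) {y : V} (hy : f y ∉ Icc s (s + h))
    (w : Fin (m + 1) → V) : TestForm.wedgeD (contDiff_sliceApprox hf s h) φ y w = 0 := by
  have hρ : deriv (sliceApprox id s h) (f y) = 0 := by
    have := abs_deriv_sliceApprox_id_le (s := s) hh (f y)
    rw [indicator_of_notMem hy, mul_zero] at this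
    exact abs_nonpos_iff.1 this
  rw [TestForm.wedgeD_apply_apply]
  refine Finset.sum_eq_zero fun l _ => ?_
  rw [fderiv_sliceApprox_eq_deriv_smul (hf.differentiable (by simp) y), hρ, zero_smul,
    zero_apply, zero_mul, mul_zero]

omit [FiniteDimensional ℝ V] [MeasurableSpace V] [BorelSpace V] in
/-- Pythagoras on an affine frame chart: with `c_l = ⟪e_l, x − p⟫`,
`|p + Σ u_l e_l − x|² = |p + Σ c_l e_l − x|² + Σ_l (u_l − c_l)²`. [cite: Federer1969, 1.7.1] -/
theorem norm_sq_affineFrameChart_sub (p x : V) {e : Fin (j + 1) → V} (he : Orthonormal ℝ e)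
    (u : Fin (j + 1) → ℝ) :
    ‖(p + ∑ l, u l • e l) - x‖ ^ 2 =
      ‖(p + ∑ l, ⟪e l, x - p⟫ • e l) - x‖ ^ 2 + ∑ l, (u l - ⟪e l, x - p⟫) ^ 2 := by
  set c : Fin (j + 1) → ℝ := fun l => ⟪e l, x - p⟫ with hc
  set a : V := (p + ∑ l, c l • e l) - x with ha
  set bv : V := ∑ l, (u l - c l) • e l with hbv
  have hsplit : (p + ∑ l, u l • e l) - x = a + bv := by
    simp only [ha, hbv, sub_smul, Finset.sum_sub_distrib]
    abel
  have horth : ⟪a, bv⟫ = 0 := by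
    have hal : ∀ l, ⟪a, e l⟫ = 0 := fun l => by
      simp only [ha, inner_sub_left, inner_add_left]
      rw [he.inner_left_fintype, conj_trivial, hc]
      simp only
      rw [inner_sub_right, real_inner_comm (e l) p, real_inner_comm (e l) x]
      ring
    simp only [hbv, inner_sum, inner_smul_right, hal, mul_zero, Finset.sum_const_zero]
  have hbn : ‖bv‖ ^ 2 = ∑ l, (u l - c l) ^ 2 := by
    rw [← real_inner_self_eq_norm_sq, hbv, he.inner_sum]
    exact Finset.sum_congr rfl fun l _ => by rw [conj_trivial, sq]
  rw [hsplit, ← hbn]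
  have := norm_add_sq_eq_norm_sq_add_norm_sq_real horth
  nlinarith [this]

omit [FiniteDimensional ℝ V] [MeasurableSpace V] [BorelSpace V] in
/-- The squared distance through an affine frame chart, `u ↦ |p + Σ u_l e_l − x|²`, has the
differential `v ↦ Σ_l 2(u_l − c_l) v_l`, `c_l = ⟪e_l, x − p⟫`. [cite: Spivak1965, Thm. 2-3] -/
theorem hasFDerivAt_norm_sq_affineFrameChart_sub (p x : V) {e : Fin (j + 1) → V}
    (he : Orthonormal ℝ e) (u : Fin (j + 1) → ℝ) :
    HasFDerivAt ((fun y : V => ‖y - x‖ ^ 2) ∘ fun u : Fin (j + 1) → ℝ => p + ∑ l, u l • e l)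
      (∑ l, (2 * (u l - ⟪e l, x - p⟫)) •
        (ContinuousLinearMap.proj l : (Fin (j + 1) → ℝ) →L[ℝ] ℝ)) u := by
  set c : Fin (j + 1) → ℝ := fun l => ⟪e l, x - p⟫ with hc
  have hfun : ((fun y : V => ‖y - x‖ ^ 2) ∘ fun u : Fin (j + 1) → ℝ => p + ∑ l, u l • e l) =
      fun u => ‖(p + ∑ l, c l • e l) - x‖ ^ 2 + ∑ l, (u l - c l) * (u l - c l) := by
    funext u
    rw [comp_apply, norm_sq_affineFrameChart_sub p x he u]
    simp only [hc, sq]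
  rw [hfun]
  have hpr : ∀ l, HasFDerivAt (fun u : Fin (j + 1) → ℝ => u l - c l)
      (ContinuousLinearMap.proj l : (Fin (j + 1) → ℝ) →L[ℝ] ℝ) u := fun l =>
    (ContinuousLinearMap.proj l : (Fin (j + 1) → ℝ) →L[ℝ] ℝ).hasFDerivAt.sub_const (c l)
  have hsum : HasFDerivAt (fun u : Fin (j + 1) → ℝ => ∑ l, (u l - c l) * (u l - c l))
      (∑ l, ((u l - c l) • (ContinuousLinearMap.proj l : (Fin (j + 1) → ℝ) →L[ℝ] ℝ) +
        (u l - c l) • (ContinuousLinearMap.proj l : (Fin (j + 1) → ℝ) →L[ℝ] ℝ))) u :=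
    HasFDerivAt.fun_sum fun l _ => (hpr l).mul (hpr l)
  have heq : (∑ l, ((u l - c l) • (ContinuousLinearMap.proj l : (Fin (j + 1) → ℝ) →L[ℝ] ℝ) +
        (u l - c l) • (ContinuousLinearMap.proj l : (Fin (j + 1) → ℝ) →L[ℝ] ℝ))) =
      ∑ l, (2 * (u l - c l)) • (ContinuousLinearMap.proj l : (Fin (j + 1) → ℝ) →L[ℝ] ℝ) :=
    Finset.sum_congr rfl fun l _ => by rw [two_mul, add_smul]
  rw [← heq]
  exact hsum.const_add _

omit [FiniteDimensional ℝ V] [MeasurableSpace V] [BorelSpace V] in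
/-- Off the critical point `c`, the differential of the squared distance through the chart does
not vanish. [cite: Spivak1965, Thm. 2-3] -/
theorem fderiv_norm_sq_affineFrameChart_sub_ne_zero (p x : V) {e : Fin (j + 1) → V}
    (he : Orthonormal ℝ e) {u : Fin (j + 1) → ℝ} (hu : u ≠ fun l => ⟪e l, x - p⟫) :
    fderiv ℝ ((fun y : V => ‖y - x‖ ^ 2) ∘ fun u : Fin (j + 1) → ℝ => p + ∑ l, u l • e l) u ≠ 0 := by
  rw [(hasFDerivAt_norm_sq_affineFrameChart_sub p x he u).fderiv]
  intro h0
  set c : Fin (j + 1) → ℝ := fun l => ⟪e l, x - p⟫ with hc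
  have h1 := congrArg (fun T : (Fin (j + 1) → ℝ) →L[ℝ] ℝ => T (u - c)) h0
  simp only [FunLike.coe_sum, Finset.sum_apply, FunLike.coe_smul, Pi.smul_apply,
    ContinuousLinearMap.proj_apply, Pi.sub_apply, smul_eq_mul, zero_apply] at h1
  -- `h1 : Σ_l 2 (u_l - c_l) (u_l - c_l) = 0`
  have h3 : ∀ l ∈ Finset.univ, 2 * (u l - ⟪e l, x - p⟫) * (u l - c l) = 0 :=
    (Finset.sum_eq_zero_iff_of_nonneg fun l _ => by
      simp only [hc]; nlinarith [sq_nonneg (u l - ⟪e l, x - p⟫)]).1 h1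
  refine hu (funext fun l => ?_)
  have := h3 l (Finset.mem_univ l)
  simp only [hc] at this
  nlinarith [this, sq_nonneg (u l - ⟪e l, x - p⟫)]

/-- **Sphere slices of one flat chart current with `L¹` integer density.** For an orthonormal
frame `e`, a base point `p`, a bounded Borel `C ⊆ ℝ^{j+1}`, an integrable `θ : ℝ^{j+1} → ℤ` and
a centre `x`, there are currents `D_t`, rectifiable for a.e. `t`, with
`∫_C θ(u) (d gₙ ∧ φ)(p + Σ u_l e_l)(e) du → D_s(φ)` for every test form `φ` and a.e. level `s`
of `f = |· − x|²` (`gₙ = S((n+1)(f − s))`): `exists_sliceData_compact` off the balls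
`B(c, 1/(k+1))` about the critical point `c = (⟪e_l, x − p⟫)_l` of `f` along the chart, whose
contribution to the level `s` vanishes as soon as `(j+1)/(k+1)² < s − f(c)`.
[cite: Federer1969, 4.3.8, 4.3.6] -/
theorem exists_sliceData_affineFrameChart (p x : V) {e : Fin (j + 1) → V} (he : Orthonormal ℝ e)
    {C : Set (Fin (j + 1) → ℝ)} (hCm : MeasurableSet C) (hCb : Bornology.IsBounded C)
    {θ : (Fin (j + 1) → ℝ) → ℤ} (hθ : IntegrableOn (fun u => (θ u : ℝ)) C)
    (hf : ContDiff ℝ ∞ fun y : V => ‖y - x‖ ^ 2) :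
    ∃ D : ℝ → Current (⊤ : Opens V) j, (∀ᵐ t, (D t).IsRectifiable) ∧
      ∀ φ : TestForm (⊤ : Opens V) j, ∀ᵐ s, Tendsto (fun n : ℕ =>
        ∫ u in C, (θ u : ℝ) * TestForm.wedgeD (contDiff_sliceApprox hf s (1 / ((n : ℝ) + 1))) φ
          (p + ∑ l, u l • e l) e) atTop (𝓝 (D s φ)) := by
  classical
  set f : V → ℝ := fun y => ‖y - x‖ ^ 2 with hfdef
  set Ψ : (Fin (j + 1) → ℝ) → V := fun u => p + ∑ l, u l • e l with hΨ
  set c : Fin (j + 1) → ℝ := fun l => ⟪e l, x - p⟫ with hc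
  set K₀ : ℝ := ‖(p + ∑ l, c l • e l) - x‖ ^ 2 with hK₀
  have hG : ∀ u, f (Ψ u) = K₀ + ∑ l, (u l - c l) ^ 2 := fun u =>
    norm_sq_affineFrameChart_sub p x he u
  have hGge : ∀ u, K₀ ≤ f (Ψ u) := fun u => by
    rw [hG]; exact le_add_of_nonneg_right (Finset.sum_nonneg fun l _ => sq_nonneg _)
  -- chart hypotheses
  have hΨs : ContDiffOn ℝ ∞ Ψ univ := (contDiff_affineFrameChart p e).contDiffOn
  have hΨinj : ∀ u ∈ (univ : Set (Fin (j + 1) → ℝ)), Injective (fderiv ℝ Ψ u) := fun u _ =>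
    injective_fderiv_affineFrameChart p he u
  have hℓ := lipschitzWith_frameCoordinates p he
  have hℓΨ : ∀ u ∈ (univ : Set (Fin (j + 1) → ℝ)), (fun l => ⟪e l, Ψ u - p⟫) = u := fun u _ =>
    frameCoordinates_affineFrameChart p he u
  obtain ⟨R', hR'⟩ := hCb.subset_closedBall c
  -- slicing off the ball `B(c, δ)`
  have hloc : ∀ δ : ℝ, 0 < δ → ∃ D : ℝ → Current (⊤ : Opens V) j, (∀ᵐ t, (D t).IsRectifiable) ∧
      ∀ φ : TestForm (⊤ : Opens V) j, ∀ᵐ s, Tendsto (fun n : ℕ =>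
        ∫ u in C \ ball c δ, (θ u : ℝ) *
          TestForm.wedgeD (contDiff_sliceApprox hf s (1 / ((n : ℝ) + 1))) φ (Ψ u) e)
          atTop (𝓝 (D s φ)) := by
    intro δ hδ
    have hK : IsCompact (closedBall c R' \ ball c δ) := (isCompact_closedBall c R').diff isOpen_ball
    have hdG : ∀ u ∈ closedBall c R' \ ball c δ, fderiv ℝ (f ∘ Ψ) u ≠ 0 := fun u hu => by
      refine fderiv_norm_sq_affineFrameChart_sub_ne_zero p x he fun h => hu.2 ?_
      rw [h]; exact mem_ball_self hδ
    obtain ⟨D, hDr, hDc⟩ := exists_sliceData_compact (V := V) isOpen_univ hΨs hΨinj hℓ hℓΨ hf hK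
      (subset_univ _) hdG (hCm.diff measurableSet_ball) (sdiff_subset_sdiff_left hR')
      (hθ.mono_set sdiff_subset)
    refine ⟨D, hDr, fun φ => ?_⟩
    filter_upwards [hDc φ] with s hs
    simpa only [hΨ, fderiv_affineFrameChart_frame] using hs
  choose Dδ hDδr hDδc using fun k : ℕ => hloc (1 / ((k : ℝ) + 1)) (by positivity)
  -- the level currents
  set kidx : ℝ → ℕ := fun s => ⌈((j : ℝ) + 1) / (s - K₀)⌉₊ with hkidx
  set D : ℝ → Current (⊤ : Opens V) j := fun s => if K₀ < s then Dδ (kidx s) s else 0 with hD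
  have hδ_small : ∀ s, K₀ < s →
      ((j : ℝ) + 1) * (1 / ((kidx s : ℝ) + 1)) ^ 2 < s - K₀ := fun s hs => by
    have hsK : 0 < s - K₀ := sub_pos.2 hs
    have h1 : ((j : ℝ) + 1) / (s - K₀) < (kidx s : ℝ) + 1 :=
      (Nat.le_ceil _).trans_lt (lt_add_one _)
    have h2 : 1 / ((kidx s : ℝ) + 1) < (s - K₀) / ((j : ℝ) + 1) := by
      rw [div_lt_div_iff₀ (by positivity) (by positivity), one_mul]
      rw [div_lt_iff₀ hsK] at h1
      linarith
    have h3 : (1 / ((kidx s : ℝ) + 1)) ^ 2 ≤ 1 / ((kidx s : ℝ) + 1) := by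
      have h4 : 1 / ((kidx s : ℝ) + 1) ≤ 1 := by
        rw [div_le_one (by positivity)]; linarith [(Nat.cast_nonneg (kidx s) : (0 : ℝ) ≤ _)]
      have h5 : 0 ≤ 1 / ((kidx s : ℝ) + 1) := by positivity
      nlinarith
    calc ((j : ℝ) + 1) * (1 / ((kidx s : ℝ) + 1)) ^ 2 ≤ ((j : ℝ) + 1) * (1 / ((kidx s : ℝ) + 1)) :=
          mul_le_mul_of_nonneg_left h3 (by positivity)
      _ < ((j : ℝ) + 1) * ((s - K₀) / ((j : ℝ) + 1)) := mul_lt_mul_of_pos_left h2 (by positivity)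
      _ = s - K₀ := by field_simp
  refine ⟨D, ?_, fun φ => ?_⟩
  · filter_upwards [ae_all_iff.2 hDδr] with s hs
    simp only [hD]
    split_ifs with h
    · exact hs _
    · exact Current.isRectifiable_zero
  · have hK₀null : ∀ᵐ s : ℝ, s ≠ K₀ := by
      have : volume ({K₀} : Set ℝ) = 0 := measure_singleton K₀
      filter_upwards [measure_eq_zero_iff_ae_notMem.1 this] with s hs
      exact fun h => hs (h ▸ mem_singleton _)
    filter_upwards [ae_all_iff.2 fun k => hDδc k φ, hK₀null] with s hs hsK₀
    rcases lt_or_gt_of_ne hsK₀ with hlt | hgt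
    · -- below the minimum: the integrand vanishes eventually
      have hDs : D s = 0 := by simp only [hD, if_neg (not_lt.2 hlt.le)]
      rw [hDs, zero_apply]
      refine tendsto_const_nhds.congr' ?_
      obtain ⟨N, hN⟩ := exists_nat_gt (1 / (K₀ - s))
      filter_upwards [eventually_ge_atTop N] with n hn
      refine (setIntegral_eq_zero_of_forall_eq_zero fun u _ => ?_).symm
      have hh : (0 : ℝ) < 1 / ((n : ℝ) + 1) := by positivity
      rw [TestForm.wedgeD_sliceApprox_apply_eq_zero hf hh φ ?_ e, mul_zero]
      intro hmem
      have h1 : f (Ψ u) ≤ s + 1 / ((n : ℝ) + 1) := hmem.2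
      have h2 : 1 / ((n : ℝ) + 1) < K₀ - s := by
        have hKs : 0 < K₀ - s := sub_pos.2 hlt
        have : 1 / (K₀ - s) < (n : ℝ) + 1 := hN.trans_le (by exact_mod_cast Nat.le_succ_of_le hn)
        rw [div_lt_iff₀ hKs] at this
        rw [div_lt_iff₀ (by positivity)]
        linarith
      linarith [hGge u]
    · -- above the minimum: the ball `B(c, δ_k)`, `k = kidx s`, does not contribute
      have hDs : D s = Dδ (kidx s) s := by simp only [hD, if_pos hgt]
      rw [hDs]
      refine (hs (kidx s)).congr fun n => ?_
      refine (setIntegral_eq_of_subset_of_forall_sdiff_eq_zero (μ := volume)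
        (f := fun u => (θ u : ℝ) *
          TestForm.wedgeD (contDiff_sliceApprox hf s (1 / ((n : ℝ) + 1))) φ (Ψ u) e)
        hCm sdiff_subset fun u hu => ?_).symm
      have huB : u ∈ ball c (1 / ((kidx s : ℝ) + 1)) := by
        by_contra h'; exact hu.2 ⟨hu.1, h'⟩
      have hh : (0 : ℝ) < 1 / ((n : ℝ) + 1) := by positivity
      rw [TestForm.wedgeD_sliceApprox_apply_eq_zero hf hh φ ?_ e, mul_zero]
      intro hmem
      have h1 : s ≤ f (Ψ u) := hmem.1
      have h2 : f (Ψ u) < s := by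
        rw [hG u]
        have hcoord : ∀ l, (u l - c l) ^ 2 < (1 / ((kidx s : ℝ) + 1)) ^ 2 := fun l => by
          have : |u l - c l| < 1 / ((kidx s : ℝ) + 1) := by
            rw [← Real.dist_eq]; exact (dist_le_pi_dist u c l).trans_lt (mem_ball.1 huB)
          exact sq_lt_sq' (by linarith [abs_lt.1 this |>.1]) (abs_lt.1 this).2
        have hsum : ∑ l, (u l - c l) ^ 2 < ((j : ℝ) + 1) * (1 / ((kidx s : ℝ) + 1)) ^ 2 := by
          calc ∑ l, (u l - c l) ^ 2 < ∑ _l : Fin (j + 1), (1 / ((kidx s : ℝ) + 1)) ^ 2 :=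
                Finset.sum_lt_sum_of_nonempty Finset.univ_nonempty fun l _ => hcoord l
            _ = ((j : ℝ) + 1) * (1 / ((kidx s : ℝ) + 1)) ^ 2 := by
                rw [Finset.sum_const, Finset.card_univ, Fintype.card_fin, nsmul_eq_mul]
                push_cast; ring
        linarith [hδ_small s hgt]
      linarith

end Face

/-! ### Sphere slices of rectifiable currents on the skeleton -/

section Main

open Cubical

variable {V : Type*} [NormedAddCommGroup V] [InnerProductSpace ℝ V] [FiniteDimensional ℝ V]
  [MeasurableSpace V] [BorelSpace V] {n : ℕ}

omit [MeasurableSpace V] [BorelSpace V] in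
/-- Second countability of the fibre of `j`-covectors over a finite-dimensional space (it is
finite-dimensional: continuous alternating maps embed into multilinear maps). [folklore] -/
private theorem secondCountableTopology_covector' (j : ℕ) : SecondCountableTopology (Covector V j) := by
  let L : (Covector V j) →ₗ[ℝ] MultilinearMap ℝ (fun _ : Fin j => V) ℝ :=
    { toFun := fun f => f.toContinuousMultilinearMap.toMultilinearMap
      map_add' := fun _ _ => rfl
      map_smul' := fun _ _ => rfl }
  have hL : Function.Injective L := fun f g h =>
    ContinuousAlternatingMap.ext fun v => (DFunLike.congr_fun h v : _)
  haveI : FiniteDimensional ℝ (Covector V j) := Module.Finite.of_injective L hL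
  haveI : ProperSpace (Covector V j) := FiniteDimensional.proper ℝ _
  infer_instance

/-- Restrictions to equal Borel sets agree (proof-irrelevance of the measurability witness).
[folklore] -/
private theorem restrictSet_congr_set' {m : ℕ} {T : Current (⊤ : Opens V) m}
    (hT : T.IsRepresentable) {A B : Set V} (hA : MeasurableSet A) (hB : MeasurableSet B)
    (h : A = B) : hT.restrictSet A hA = hT.restrictSet B hB := by
  subst h; rfl

/-- **Sphere slices of a rectifiable current carried by the `(j+1)`-skeleton are rectifiable,
almost every radius.** Let `Q ∈ 𝓡_{j+1}(V)` with `spt Q ⊆ μ_ε W'_{j+1}` and `𝐌(∂Q) < ∞`, and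
`x ∈ V`. Then for almost every `r > 0` the slice
`⟨Q, |· − x|², r²+⟩ = ∂(Q ⌞ 𝐁(x, r)) − (∂Q) ⌞ 𝐁(x, r)` is a rectifiable `j`-current: face by
face (`Current.IsRectifiable.exists_faceCharts`) the slices are level currents of flat charts
with `L¹` integer densities (`exists_sliceData_affineFrameChart`, from `exists_sliceData_chart`),
`Q(d gₙ ∧ φ)` converges both to their sum and to the slice
(`Current.IsRepresentable.tendsto_wedgeD_slice`), and two currents of finite mass agreeing on
a countable sup-dense family of forms agree. [cite: Federer1969, 4.3.8, 4.3.6, 4.2.1;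
White1989, p. 210] -/
theorem Current.IsRectifiable.ae_isRectifiable_sphereSlice (b : OrthonormalBasis (Fin n) ℝ V)
    {ε : ℝ} (hε : 0 < ε) {j : ℕ} {Q : Current (⊤ : Opens V) (j + 1)} (hQ : Q.IsRectifiable)
    (hsupp : Q.support ⊆ skeletonV b (j + 1) ε) (hdQ : Q.boundary.mass ≠ ⊤) (x : V) :
    ∀ᵐ r : ℝ, 0 < r →
      (((Q.isRepresentable_of_mass_ne_top hQ.mass_ne_top').restrictSet (closedBall x r)
          measurableSet_closedBall).boundary -
        (Q.boundary.isRepresentable_of_mass_ne_top hdQ).restrictSet (closedBall x r)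
          measurableSet_closedBall).IsRectifiable := by
  classical
  have hQm : Q.mass ≠ ⊤ := hQ.mass_ne_top'
  have hQr : Q.IsRepresentable := Q.isRepresentable_of_mass_ne_top hQm
  have hdQr : Q.boundary.IsRepresentable := Q.boundary.isRepresentable_of_mass_ne_top hdQ
  set f : V → ℝ := fun y => ‖y - x‖ ^ 2 with hfdef
  have hf : ContDiff ℝ ∞ f := (contDiff_norm_sq ℝ).comp (contDiff_id.sub contDiff_const)
  /- (1) face charts and their level currents -/
  obtain ⟨F, p, e, C, θ, he, hCm, hCb, hθ, hQω⟩ := hQ.exists_faceCharts b hε hsupp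
  have hfaces : ∀ z ∈ F, ∃ D : ℝ → Current (⊤ : Opens V) j, (∀ᵐ t, (D t).IsRectifiable) ∧
      ∀ φ : TestForm (⊤ : Opens V) j, ∀ᵐ s, Tendsto (fun n : ℕ =>
        ∫ u in C z, (θ z u : ℝ) * TestForm.wedgeD (contDiff_sliceApprox hf s (1 / ((n : ℝ) + 1)))
          φ (p z + ∑ l, u l • e z l) (e z)) atTop (𝓝 (D s φ)) := fun z hz =>
    exists_sliceData_affineFrameChart (p z) x (he z hz) (hCm z hz) (hCb z hz) (hθ z hz) hf
  choose! D hDr hDc using hfaces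
  set Es : ℝ → Current (⊤ : Opens V) j := fun s => ∑ z ∈ F, D z s with hEs
  have hEr : ∀ᵐ s, (Es s).IsRectifiable := by
    filter_upwards [(eventually_all_finset F).2 fun z hz => hDr z hz] with s hs
    exact Finset.sum_induction _ (fun T : Current (⊤ : Opens V) j => T.IsRectifiable)
      (fun _ _ ha hb => ha.add_top hb) Current.isRectifiable_zero (fun z hz => hs z hz)
  have hEconv : ∀ φ : TestForm (⊤ : Opens V) j, ∀ᵐ s, Tendsto (fun n : ℕ =>
      Q (TestForm.wedgeD (contDiff_sliceApprox hf s (1 / ((n : ℝ) + 1))) φ)) atTop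
        (𝓝 (Es s φ)) := fun φ => by
    filter_upwards [(eventually_all_finset F).2 fun z hz => hDc z hz φ] with s hs
    have h1 : (fun n : ℕ => Q (TestForm.wedgeD (contDiff_sliceApprox hf s (1 / ((n : ℝ) + 1))) φ)) =
        fun n : ℕ => ∑ z ∈ F, ∫ u in C z, (θ z u : ℝ) *
          TestForm.wedgeD (contDiff_sliceApprox hf s (1 / ((n : ℝ) + 1))) φ
            (p z + ∑ l, u l • e z l) (e z) := funext fun n => hQω _
    have h2 : Es s φ = ∑ z ∈ F, D z s φ := by
      simp only [hEs, FunLike.coe_sum, Finset.sum_apply]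
    rw [h1, h2]
    exact tendsto_finsetSum F fun z hz => hs z hz
  /- (2) the slice at the level `s` agrees with `E_s` on every test form, a.e. -/
  have hae_eq : ∀ φ : TestForm (⊤ : Opens V) j, ∀ᵐ s,
      hQr.slice hdQr hf.continuous s φ = Es s φ := fun φ => by
    filter_upwards [hEconv φ] with s hs
    exact tendsto_nhds_unique (hQr.tendsto_wedgeD_slice hdQr hf s φ) hs
  haveI : SecondCountableTopology (Covector V j) := secondCountableTopology_covector' j
  obtain ⟨Dset, hDsc, hDsd⟩ :=
    TestFunction.exists_countable_sup_dense (F := Covector V j) (⊤ : Opens V) (⊤ : ℕ∞)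
  have hae_D : ∀ᵐ s, ∀ d ∈ Dset, hQr.slice hdQr hf.continuous s d = Es s d :=
    (ae_ball_iff hDsc).2 fun d _ => hae_eq d
  /- (3) good levels, transported to radii -/
  obtain ⟨N, hNm, hN0, hN⟩ : ∃ N : Set ℝ, MeasurableSet N ∧ volume N = 0 ∧ ∀ s ∉ N,
      (∀ d ∈ Dset, hQr.slice hdQr hf.continuous s d = Es s d) ∧ (Es s).IsRectifiable := by
    have h := hae_D.and hEr
    rw [ae_iff] at h
    refine ⟨toMeasurable volume _, measurableSet_toMeasurable _ _, by rwa [measure_toMeasurable],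
      fun s hs => ?_⟩
    have : ¬¬(_ ∧ _) := fun h' => hs (subset_toMeasurable _ _ h')
    exact not_not.1 this
  have hgdiff : DifferentiableOn ℝ Real.sqrt (N ∩ Ioi 0) := fun s hs =>
    (Real.hasDerivAt_sqrt (ne_of_gt hs.2)).differentiableAt.differentiableWithinAt
  have himg0 : volume (Real.sqrt '' (N ∩ Ioi 0)) = 0 :=
    addHaar_image_eq_zero_of_differentiableOn_of_addHaar_eq_zero volume hgdiff
      (measure_mono_null inter_subset_left hN0)
  /- (4) finite boundary mass of the pieces outside the balls, a.e. radius -/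
  have hbm := hQr.ae_mass_boundary_restrictSet_lt_top hdQr (LipschitzWith.dist_left x) hQm hdQ
  filter_upwards [measure_eq_zero_iff_ae_notMem.1 himg0, hbm] with r hrN hbr hr0
  have hsN : r ^ 2 ∉ N := fun h =>
    hrN ⟨r ^ 2, ⟨h, by simp only [mem_Ioi]; positivity⟩, by rw [Real.sqrt_sq hr0.le]⟩
  obtain ⟨hDeq, hErect⟩ := hN _ hsN
  -- the relevant sets
  have hset1 : {y | r ^ 2 < f y} = (closedBall x r)ᶜ := by
    ext y
    simp only [hfdef, mem_setOf_eq, mem_compl_iff, mem_closedBall, not_le, dist_eq_norm]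
    exact sq_lt_sq₀ hr0.le (norm_nonneg _)
  have hset2 : {y | r < dist y x} = (closedBall x r)ᶜ := by
    ext y; simp [mem_closedBall, not_le]
  have hmc : MeasurableSet (closedBall x r)ᶜ := measurableSet_closedBall.compl
  -- the slice at level `r²` is `(∂Q) ⌞ 𝐁ᶜ − ∂(Q ⌞ 𝐁ᶜ)`
  have hslice : hQr.slice hdQr hf.continuous (r ^ 2) =
      hdQr.restrictSet (closedBall x r)ᶜ hmc - (hQr.restrictSet (closedBall x r)ᶜ hmc).boundary := by
    unfold Current.IsRepresentable.slice
    rw [restrictSet_congr_set' hdQr _ hmc hset1, restrictSet_congr_set' hQr _ hmc hset1]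
  -- finite masses
  have hm1 : (hQr.slice hdQr hf.continuous (r ^ 2)).mass ≠ ⊤ := by
    rw [hslice, sub_eq_add_neg]
    refine ne_top_of_le_ne_top ?_ (Current.mass_add_le _ _)
    refine ENNReal.add_ne_top.2 ⟨?_, ?_⟩
    · exact ne_top_of_le_ne_top hdQ
        ((hdQr.mass_restrictSet_le _).trans (Q.boundary.variation_le_mass _))
    · rw [Current.mass_neg, ← restrictSet_congr_set' hQr (measurableSet_lt_of_continuous
        (LipschitzWith.dist_left x).continuous r) hmc hset2]
      exact hbr.ne
  have hm2 : (Es (r ^ 2)).mass ≠ ⊤ := hErect.mass_ne_top'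
  have heqE : hQr.slice hdQr hf.continuous (r ^ 2) = Es (r ^ 2) :=
    Current.eq_of_eqOn_supDense hDsd hm1 hm2 hDeq
  -- `∂(Q ⌞ 𝐁) − (∂Q) ⌞ 𝐁 = (∂Q) ⌞ 𝐁ᶜ − ∂(Q ⌞ 𝐁ᶜ)`
  have hQsplit := hQr.restrictSet_add_compl (measurableSet_closedBall (x := x) (ε := r))
  have hdQsplit := hdQr.restrictSet_add_compl (measurableSet_closedBall (x := x) (ε := r))
  have hA : (hQr.restrictSet (closedBall x r) measurableSet_closedBall).boundary =
      Q.boundary - (hQr.restrictSet (closedBall x r)ᶜ hmc).boundary := by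
    refine eq_sub_of_add_eq ?_
    rw [← Current.boundary_add, hQsplit]
  have hB : hdQr.restrictSet (closedBall x r) measurableSet_closedBall =
      Q.boundary - hdQr.restrictSet (closedBall x r)ᶜ hmc := eq_sub_of_add_eq hdQsplit
  have hfinal : (hQr.restrictSet (closedBall x r) measurableSet_closedBall).boundary -
      hdQr.restrictSet (closedBall x r) measurableSet_closedBall =
      hQr.slice hdQr hf.continuous (r ^ 2) := by
    rw [hslice, hA, hB]; abel
  rw [show (Q.isRepresentable_of_mass_ne_top hQ.mass_ne_top') = hQr from rfl,
    show (Q.boundary.isRepresentable_of_mass_ne_top hdQ) = hdQr from rfl, hfinal, heqE]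
  exact hErect

end Main

end Literature.Geometry.GeometricMeasureTheory
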